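import Literature.Analysis.FunctionSpaces.TranslationAverageBounds
import Literature.MathematicalPhysics.QuantumLattice.SchwartzTranslationCutoff
import HarnessLib

/-!
# The averaging operator as an approximate identity on the Schwartz space

Analysis/FunctionSpaces support file (everything proved, no definitions), sequel of
`TranslationAverageBounds`: the averaging operators `K_{A,h} u = ∫ h(a) u(· - Aa) da`
(`SchwartzAverage.translationAverage`) converge to the identity **in the Schwartz topology** as the
weight `h` concentrates at the origin with mass one:

  `p_{k,l}(K_{A,h} u - u) ≤ (∫‖h‖) · sup_{‖a‖ ≤ R} p_{k,l}(u(· - Aa) - u)`   (`seminorm_translationAverage_sub_le`),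

for `∫ h = 1` and `h = 0` outside the ball of radius `R`; and the modulus of continuity on the
right tends to `0` with `R` by continuity of translations on `𝓢` (`continuous_compSubConstCLM`), so

  `∀ ε > 0 ∃ R > 0 ∀ h (mass one, ∫‖h‖ ≤ 1, supported in radius R): p_{k,l}(K_{A,h} u - u) ≤ ε`
  (`exists_radius_seminorm_translationAverage_sub_le`).

This is the step "remove the time regularisation" in Osterwalder–Schrader II (Comm. Math. Phys. 42
(1975)), Ch. VI.1: the regularised clusters converge to the sharp ones in `𝓢` as the time profiles
shrink, uniformly as needed thanks to the uniform bounds of `OSRegularisedClusterBounds`.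
-/

noncomputable section

open MeasureTheory Set Filter Metric
open scoped _root_.Topology SchwartzMap

namespace Literature.Analysis.FunctionSpaces.SchwartzAverage

variable {P V : Type*}
  [NormedAddCommGroup P] [InnerProductSpace ℝ P] [FiniteDimensional ℝ P]
  [MeasurableSpace P] [BorelSpace P]
  [NormedAddCommGroup V] [InnerProductSpace ℝ V] [FiniteDimensional ℝ V]
  [MeasurableSpace V] [BorelSpace V]

/-- Derivatives of the difference `K_{A,h} u - u` for a weight of mass one:
`Dˡ(K u - u)(x) = ∫ h(a) (Dˡu(x - Aa) - Dˡu(x)) da`. [folklore] -/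
theorem iteratedFDeriv_translationAverage_sub (A : P →L[ℝ] V) (h : 𝓢(P, ℂ)) (hmass : ∫ a, h a = 1)
    (l : ℕ) (u : 𝓢(V, ℂ)) (x : V) :
    iteratedFDeriv ℝ l (⇑(translationAverage A h u - u)) x =
      ∫ a, h a • (iteratedFDeriv ℝ l u (x - A a) - iteratedFDeriv ℝ l u x) := by
  have hsub : (⇑(translationAverage A h u - u) : V → _) = ⇑(translationAverage A h u) - ⇑u := rfl
  rw [hsub, iteratedFDeriv_sub_apply ((translationAverage A h u).smooth l).contDiffAt (u.smooth l).contDiffAt,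
    iteratedFDeriv_translationAverage A h l u x]
  have hint1 : Integrable (fun a => h a • iteratedFDeriv ℝ l u (x - A a)) := integrable_smul_iteratedFDeriv A h l u x
  have hint2 : Integrable (fun a => h a • iteratedFDeriv ℝ l u x) := h.integrable.smul_const _
  simp_rw [smul_sub]
  rw [integral_sub hint1 hint2, integral_smul_const, hmass, one_smul]

/-- **The averaging operator minus the identity through the modulus of continuity of
translations**: for `∫ h = 1`, `h = 0` outside radius `R`, and any `ω` with
`p_{k,l}(u(· - Aa) - u) ≤ ω` for `‖a‖ ≤ R`:  `p_{k,l}(K_{A,h} u - u) ≤ (∫‖h‖) ω`. [folklore] -/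
theorem seminorm_translationAverage_sub_le (A : P →L[ℝ] V) (h : 𝓢(P, ℂ)) (hmass : ∫ a, h a = 1)
    {R : ℝ} (hsupp : ∀ a, R < ‖a‖ → h a = 0) (u : 𝓢(V, ℂ)) (k l : ℕ) {ω : ℝ} (hω0 : 0 ≤ ω)
    (hω : ∀ a : P, ‖a‖ ≤ R → SchwartzMap.seminorm ℂ k l (SchwartzMap.compSubConstCLM ℂ (A a) u - u) ≤ ω) :
    SchwartzMap.seminorm ℂ k l (translationAverage A h u - u) ≤ (∫ a, ‖h a‖) * ω := by
  have hI0 : 0 ≤ ∫ a, ‖h a‖ := integral_nonneg fun _ => norm_nonneg _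
  refine SchwartzMap.seminorm_le_bound ℂ k l _ (by positivity) fun x => ?_
  rw [iteratedFDeriv_translationAverage_sub A h hmass l u x]
  -- pointwise bound of the integrand by `‖h a‖ ω / ‖x‖^k`-type estimate
  have hpt : ∀ a : P, ‖x‖ ^ k * ‖h a • (iteratedFDeriv ℝ l u (x - A a) - iteratedFDeriv ℝ l u x)‖ ≤ ‖h a‖ * ω := by
    intro a
    by_cases ha : R < ‖a‖
    · rw [hsupp a ha, zero_smul, norm_zero, mul_zero, norm_zero, zero_mul]
    · rw [norm_smul]
      have hd : iteratedFDeriv ℝ l u (x - A a) - iteratedFDeriv ℝ l u x =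
          iteratedFDeriv ℝ l (⇑(SchwartzMap.compSubConstCLM ℂ (A a) u - u)) x := by
        have hsub : (⇑(SchwartzMap.compSubConstCLM ℂ (A a) u - u) : V → _) =
            ⇑(SchwartzMap.compSubConstCLM ℂ (A a) u) - ⇑u := rfl
        rw [hsub, iteratedFDeriv_sub_apply ((SchwartzMap.compSubConstCLM ℂ (A a) u).smooth l).contDiffAt
          (u.smooth l).contDiffAt]
        congr 1
        have hfun : (⇑(SchwartzMap.compSubConstCLM ℂ (A a) u) : V → ℂ) = fun y => u (y - A a) := by
          funext y; simp
        rw [hfun, iteratedFDeriv_comp_sub]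
      rw [hd]
      calc ‖x‖ ^ k * (‖h a‖ * ‖iteratedFDeriv ℝ l (⇑(SchwartzMap.compSubConstCLM ℂ (A a) u - u)) x‖)
          = ‖h a‖ * (‖x‖ ^ k * ‖iteratedFDeriv ℝ l (⇑(SchwartzMap.compSubConstCLM ℂ (A a) u - u)) x‖) := by ring
        _ ≤ ‖h a‖ * ω := mul_le_mul_of_nonneg_left
            ((SchwartzMap.le_seminorm ℂ k l _ x).trans (hω a (not_lt.1 ha))) (norm_nonneg _)
  calc ‖x‖ ^ k * ‖∫ a, h a • (iteratedFDeriv ℝ l u (x - A a) - iteratedFDeriv ℝ l u x)‖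
      ≤ ‖x‖ ^ k * ∫ a, ‖h a • (iteratedFDeriv ℝ l u (x - A a) - iteratedFDeriv ℝ l u x)‖ := by
        gcongr; exact norm_integral_le_integral_norm _
    _ = ∫ a, ‖x‖ ^ k * ‖h a • (iteratedFDeriv ℝ l u (x - A a) - iteratedFDeriv ℝ l u x)‖ := by
        rw [integral_const_mul]
    _ ≤ ∫ a, ‖h a‖ * ω := by
        refine integral_mono_of_nonneg (Eventually.of_forall fun a => by positivity) (h.integrable.norm.mul_const ω)
          (Eventually.of_forall hpt)
    _ = (∫ a, ‖h a‖) * ω := integral_mul_const ω _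

omit [FiniteDimensional ℝ P] [MeasurableSpace P] [BorelSpace P] [FiniteDimensional ℝ V] [MeasurableSpace V] [BorelSpace V] in
/-- **The modulus of continuity of translations tends to zero**: for every `ε > 0` there is `R > 0`
with `p_{k,l}(u(· - Aa) - u) ≤ ε` for `‖a‖ ≤ R`. [folklore] -/
theorem exists_radius_seminorm_compSubConstCLM_sub_le (A : P →L[ℝ] V) (u : 𝓢(V, ℂ)) (k l : ℕ) {ε : ℝ} (hε : 0 < ε) :
    ∃ R : ℝ, 0 < R ∧ ∀ a : P, ‖a‖ ≤ R → SchwartzMap.seminorm ℂ k l (SchwartzMap.compSubConstCLM ℂ (A a) u - u) ≤ ε := by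
  -- continuity of `a ↦ u(· - Aa)` at `a = 0` in the Schwartz topology
  have hcont : Continuous fun a : P => SchwartzMap.compSubConstCLM ℂ (A a) u :=
    (Literature.MathematicalPhysics.QuantumLattice.continuous_compSubConstCLM (𝕜 := ℂ) u).comp A.continuous
  have h0 : SchwartzMap.compSubConstCLM ℂ (A 0) u = u := by
    ext y; simp
  have htend : Tendsto (fun a : P => SchwartzMap.compSubConstCLM ℂ (A a) u - u) (𝓝 0) (𝓝 0) := by
    have := (hcont.tendsto 0).sub (tendsto_const_nhds (x := u))
    rwa [h0, sub_self] at this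
  have hsem : Tendsto (fun a : P => SchwartzMap.seminorm ℂ k l (SchwartzMap.compSubConstCLM ℂ (A a) u - u)) (𝓝 0) (𝓝 0) := by
    have hc := ((schwartz_withSeminorms ℂ V ℂ).continuous_seminorm (k, l)).tendsto 0
    rw [map_zero] at hc
    exact hc.comp htend
  have hev : ∀ᶠ a in 𝓝 (0 : P), SchwartzMap.seminorm ℂ k l (SchwartzMap.compSubConstCLM ℂ (A a) u - u) < ε :=
    hsem.eventually (Iio_mem_nhds hε)
  obtain ⟨δ, hδ, hball⟩ := Metric.eventually_nhds_iff.1 hev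
  refine ⟨δ / 2, by positivity, fun a ha => (hball ?_).le⟩
  rw [dist_zero_right]
  linarith

/-- **The averaging operators are an approximate identity on `𝓢`**: for every `u`, `k, l`, `ε > 0`
there is `R > 0` such that every weight `h` of mass one with `∫‖h‖ ≤ 1` supported in the ball of
radius `R` satisfies `p_{k,l}(K_{A,h} u - u) ≤ ε`. [folklore] -/
theorem exists_radius_seminorm_translationAverage_sub_le (A : P →L[ℝ] V) (u : 𝓢(V, ℂ)) (k l : ℕ) {ε : ℝ} (hε : 0 < ε) :
    ∃ R : ℝ, 0 < R ∧ ∀ h : 𝓢(P, ℂ), (∫ a, h a = 1) → (∫ a, ‖h a‖ ≤ 1) → (∀ a, R < ‖a‖ → h a = 0) →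
      SchwartzMap.seminorm ℂ k l (translationAverage A h u - u) ≤ ε := by
  obtain ⟨R, hR, hω⟩ := exists_radius_seminorm_compSubConstCLM_sub_le A u k l hε
  refine ⟨R, hR, fun h hmass hnorm hsupp => ?_⟩
  refine (seminorm_translationAverage_sub_le A h hmass hsupp u k l hε.le hω).trans ?_
  calc (∫ a, ‖h a‖) * ε ≤ 1 * ε := mul_le_mul_of_nonneg_right hnorm hε.le
    _ = ε := one_mul ε

end Literature.Analysis.FunctionSpaces.SchwartzAverage
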